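import Literature.MathematicalPhysics.QuantumFieldTheory.Balaban1983to89.B6Hprime2132Torus
import Literature.MathematicalPhysics.QuantumFieldTheory.Balaban1983to89.B5Momentum133

/-!
# `Balaban1983to89.B6Hprime2101TorusAlgebra` — T. Bałaban, *Propagators and renormalization transformations for lattice
# gauge theories. II*, Commun. Math. Phys. **96** (1984) 223–250 [Balaban1984PropagatorsII], pp. 241–242: the typed torus
# `H′_j` IS the operator of (2.101)/(2.102) — `Δ²H′_j = Q′_j*Δ′_j` (the Euler–Lagrange equation of (2.102), i.e.
# (2.99)–(2.101)), `λ = H′_jμ` minimises `½‖Δλ′‖²` on `{Q′_jλ′ = μ}` (2.102), and `Δ′_j = H′_j*Δ²H′_j` (2.107) with the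
# typed `Δ′_j` of (2.108)

statement-level skeleton of published theorems with citation tags; proofs where landed; nothing here is a claim about the Yang–Mills mass gap

PDF held: `paper:balaban1984-cmp96-propagators-rt-ii` (journal page = PDF page + 222); pp. 241, 242 [PDF 19, 20] read AS
IMAGES on the ×2 renders `…/1984-cmp96-propagators-rt-II-p019-x2.png`, `…-p020-x2.png`.

CITATION HEADER (lean-in-tree rule).  WHAT IS REPRODUCED: lit-balaban SKELETON rows **B6.Eq2.98** ((2.98)–(2.102) p. 241)
and **B6.Eq2.105** ((2.107) p. 242) / **B6.Eq2.108** ((2.108)) FOR THE TYPED TORUS OPERATORS of `…B6Hprime2132Torus`.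
p. 241, verbatim: *"for all A, hence for A = 0: (I − P_j)Δλ = 0, (2.99) or Δλ = Δ⁻¹Q′_j*(Q′_jΔ⁻²Q′_j*)⁻¹Q′_jΔ⁻¹Δλ.
(2.100) We may assume also that λ is orthogonal to constant functions … hence λ = Δ⁻²Q′_j*(Q′_jΔ⁻²Q′_j*)⁻¹μ,
μ = Q′_jλ. (2.101) … It gives a solution of the variational problem inf_{λ′: Q′_jλ′=μ} ½‖Δλ′‖². (2.102) Let us denote the
operator in (2.101) by H′_j, so λ = H′_jμ."*; p. 242: *"and the operator Δ′_j was defined by the second equality,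
Δ′_j = H′_j*Δ²H′_j. (2.107) In momentum representation on the unit lattice the operator Δ′_j is represented as the
multiplication operator by the function Δ′_j(p′) = Δ₀²(p′)(Σ_l|u_j(p′+l)|²Δ₀²(p′)/Δ²(p′+l))⁻¹. (2.108)"*.
`…B6Hprime2132Torus` (r03 g6) typed `H′_j = HpOp n M` BY ITS MOMENTUM REPRESENTATION (2.132) and certified `Q′_jH′_j = 1`,
leaving as honest scope the identification with the operator DEFINED by (2.101).  THIS FILE supplies that identification in
the form that makes sense on a finite torus (where `Δ` has the constant zero mode, so the literal `Δ⁻²` of (2.101) is the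
pseudo-inverse on `λ ⊥ constants`): the typed `H′_j` satisfies the EULER–LAGRANGE SYSTEM of (2.102) — `Q′_jλ = μ` and
`Δ²λ = Q′_j*ν` with the explicit multiplier `ν = Δ′_jμ` — which is (2.99)/(2.100) (`Δ²λ ∈ Range Q′_j*` ⟺ `(I − P_j)Δλ = 0`,
row B6.Eq2.98's abstract `B6Eq295.eq298_iff_eq299`/`eq2101_of_eq299`), HENCE minimises (2.102), uniquely; and (2.107)
holds as an identity of typed operators with the typed `Δ′_j = dPOp` whose momentum representation is (2.108).
Unit `lit-balaban-r03` (B6 reader/typer and fold owner, gen 6), PHASE 2 (G.1/G.2(b) knitting), HOME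
`run/shared/lean/pub/lit-balaban/`, 2026-08-21.  IMPORTS `…B6Hprime2132Torus` and `…B5Momentum133` (hence `…B5Momentum130`,
`…B5LaplaceInverse`, `…B5LaplaceSpectral`, `…B5Adjoint130`: `dft_LapS_apply`, `lsym_pOf`, `lsym_eq_zero_iff`,
`LapS_isHermitian`, `dft_QsOp_adjoint`) — everything BY NAME; nothing restated; no new named fact.

WEIGHTS (dictionary, ours).  B5/B6 pair functions on `T_η` with the weight `η^d` and on `T₁` with weight `1`; the
paper's adjoints are taken in these weighted products, so `Q′_j* = η^{−d}·(QsOp)ᴴ = n^d·(QsOp)ᴴ` (the plain matrix adjoint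
`(QsOp)ᴴ` copies `η^d·μ(y)` to the block of `y`, `B5Adjoint130.QsOp_adjoint_mulVec`) and `H′_j* = η^d·(HpOp)ᴴ`.  With this
dictionary the statements below are LITERALLY `Δ²H′_j = Q′_j*Δ′_j` and `H′_j*Δ²H′_j = Δ′_j`.

## Content (sorry-free; `[cite: …]` tags are TEXT LOCATIONS; the mathematics is `[folklore]` Fourier bookkeeping)

* §1 `dPOp n M` — the TYPED `Δ′_j`: the coarse-torus operator with momentum multiplier `Δ′_j(p′) = B6Hprime2101.dP`
  ((2.108) regrouped; `= dPrinted` off `Δ(p′) = 0`, `B6Hprime2101.dP_eq_printed`); `dft_dPOp`.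
* §2 `symbol_2100`: the alias-wise symbol identity `Δ(p′+l)²·h′_l(p′) = ū(p′+l)·Δ′_j(p′)` at every torus momentum.
* §3 **`LapS_LapS_HpOp_mulVec` / `LapS_mul_LapS_mul_HpOp`: `Δ²H′_j = n^d·(QsOp)ᴴ·Δ′_j = Q′_j*Δ′_j`** — (2.99)/(2.100)/(2.101)
  for the typed operator: `Δ²(H′_jμ) ∈ Range Q′_j*` with the multiplier `Δ′_jμ`.
* §4 **`eq2107_typed`: `H′_j*Δ²H′_j = Δ′_j`**, i.e. `(HpOp)ᴴ·Δ²·HpOp = n^d·dPOp` (2.107).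
* §5 **`variational_2102`**: for every `λ′` with `Q′_jλ′ = μ`, `‖Δ(H′_jμ)‖² ≤ ‖Δλ′‖²` (the cross term is
  `⟨Q′_j(λ′ − H′_jμ), Δ′_jμ⟩ = 0`), and UNIQUENESS `eq_HpOp_of_minimiser`: `‖Δλ′‖² ≤ ‖Δ(H′_jμ)‖²` forces
  `Δ(λ′ − H′_jμ) = 0`, hence `λ′ − H′_jμ` constant (`B5Momentum130.lsym_eq_zero_iff`), hence `0` by `Q′_j(λ′ − H′_jμ) = 0` —
  *"It gives a solution of the variational problem (2.102)"*, and the solution is unique: `HpOp` IS the `H′_j` of (2.101).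

## Honest scope

(i) TORUS MODEL ONLY (finite periodic lattices).  (ii) The literal (2.101) with `Δ⁻²` is not typed (on the torus `Δ` is
singular on constants; the paper's *"λ orthogonal to constant functions"*); what is certified is its Euler–Lagrange /
variational content (2.99)–(2.102) and (2.107)–(2.108), which determine `H′_j` uniquely.  (iii) `U = 1`, massless, complex
scalar functions (the paper's are real; all statements specialise).  (iv) Value = kernel certificate of bookkeeping for
located, asserted steps of [Balaban1984PropagatorsII]; NOT summit progress, NOT continuum, NOT Clay.
-/

open scoped BigOperators Matrix ComplexConjugate Real
open Finset Complex

namespace Literature.MathematicalPhysics.QuantumFieldTheory.Balaban1983to89.B6Hprime2101TorusAlgebra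

open Literature.MathematicalPhysics.QuantumFieldTheory.Balaban1983to89.B4Strip (ofRealVec shift shift_zero DeltaXi
  DeltaXir)
open Literature.MathematicalPhysics.QuantumFieldTheory.Balaban1983to89.B5Prop11Plancherel (Tor chi dft fine sOf
  dft_mem_unitaryGroup)
open Literature.MathematicalPhysics.QuantumFieldTheory.Balaban1983to89.B5Prop11Fiber (uSym)
open Literature.MathematicalPhysics.QuantumFieldTheory.Balaban1983to89.B5Action121 (LapS)
open Literature.MathematicalPhysics.QuantumFieldTheory.Balaban1983to89.B5Block118 (pOf pOf_injective pOf_bijective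
  QsOp dft_QsOp cQ cQ_eq)
open Literature.MathematicalPhysics.QuantumFieldTheory.Balaban1983to89.B5Constraint130 (cQ_ne_zero)
open Literature.MathematicalPhysics.QuantumFieldTheory.Balaban1983to89.B5Adjoint130 (dft_QsOp_adjoint)
open Literature.MathematicalPhysics.QuantumFieldTheory.Balaban1983to89.B5LaplaceInverse (lsym
  dft_mul_conjTranspose dft_conjTranspose_mul)
open Literature.MathematicalPhysics.QuantumFieldTheory.Balaban1983to89.B5LaplaceSpectral (LapS_isHermitian)
open Literature.MathematicalPhysics.QuantumFieldTheory.Balaban1983to89.B5Momentum130 (lsym_eq_zero_iff dft_LapS_apply)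
open Literature.MathematicalPhysics.QuantumFieldTheory.Balaban1983to89.B5Momentum133 (lsym_pOf)
open Literature.MathematicalPhysics.QuantumFieldTheory.Balaban1983to89.B5Strip145 (Ncal)
open Literature.MathematicalPhysics.QuantumFieldTheory.Balaban1983to89.B5Hk163Strip (uCbar uCbar_ofReal rho
  DeltaXi_shift_ofReal)
open Literature.MathematicalPhysics.QuantumFieldTheory.Balaban1983to89.B5Hk163Torus (dft_mulVec_injective)
open Literature.MathematicalPhysics.QuantumFieldTheory.Balaban1983to89.B6Hprime2101 (hP dP)
open Literature.MathematicalPhysics.QuantumFieldTheory.Balaban1983to89.B6Hprime2132Torus (HpOp dft_HpOp QsOp_HpOp_mulVec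
  QsOp_mul_HpOp)

noncomputable section

variable {d : ℕ}

/-! ## §1. The typed `Δ′_j` of (2.107)/(2.108) -/

section DeltaPrime

variable (n : ℕ) [NeZero n] (M : Fin d → ℕ) [hM : ∀ μ, NeZero (M μ)]

/-- **THE TYPED `Δ′_j`**: the operator on unit-lattice (coarse torus) scalar functions whose momentum representation is the
multiplication by `Δ′_j(p′)` — (2.108), here the regrouped `B6Hprime2101.dP` (`= dPrinted` off `Δ(p′) = 0`).
[cite: Balaban1984PropagatorsII, (2.107)–(2.108) p.242 «In momentum representation on the unit lattice the operator Δ′_j is represented as the multiplication operator by the function Δ′_j(p′)»] [folklore] -/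
def dPOp : Matrix (Tor M) (Tor M) ℂ :=
  (dft M)ᴴ * Matrix.diagonal (fun q => dP n (ofRealVec (sOf M q))) * dft M

/-- the momentum representation of the typed `Δ′_j`: `(Δ′_jμ)^(p′) = Δ′_j(p′)·μ̂(p′)`.
[cite: Balaban1984PropagatorsII, (2.108) p.242] [folklore] -/
theorem dft_dPOp (μf : Tor M → ℂ) (q : Tor M) :
    (dft M *ᵥ (dPOp n M *ᵥ μf)) q = dP n (ofRealVec (sOf M q)) * (dft M *ᵥ μf) q := by
  have h : dft M * dPOp n M = Matrix.diagonal (fun q => dP n (ofRealVec (sOf M q))) * dft M := by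
    unfold dPOp
    rw [← Matrix.mul_assoc, ← Matrix.mul_assoc, dft_mul_conjTranspose, Matrix.one_mul]
  rw [Matrix.mulVec_mulVec, h, ← Matrix.mulVec_mulVec, Matrix.mulVec_diagonal]

end DeltaPrime

/-! ## §2. The alias-wise symbol identity behind (2.100): `Δ(p′+l)² h′_l(p′) = ū(p′+l) Δ′_j(p′)` -/

section Symbol

variable (n : ℕ) [NeZero n] (M : Fin d → ℕ) [hM : ∀ μ, NeZero (M μ)]

/-- at a torus momentum `p′ + l ≠ 0` (i.e. `(l, p′) ≠ (0, 0)`) the fine Laplace symbol `Δ(p′+l)` does not vanish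
(`B5Momentum130.lsym_eq_zero_iff` + `B5Momentum133.lsym_pOf`). [folklore] -/
private theorem DeltaXi_shift_sOf_ne_zero {k : Fin d → Fin n} {q : Tor M} (hkq : (k, q) ≠ ((fun _ => 0), 0)) :
    DeltaXi n 0 (shift n k (ofRealVec (sOf M q))) ≠ 0 := by
  have hn : (n : ℂ) ≠ 0 := by exact_mod_cast NeZero.ne n
  have hp : pOf n M (k, q) ≠ 0 := by
    intro h
    have h0 : pOf n M ((fun _ => 0), 0) = 0 := by
      funext ν; simp [pOf]
    exact hkq (pOf_injective n M (h.trans h0.symm))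
  have hl : lsym (fine n M) (n : ℂ) (pOf n M (k, q)) ≠ 0 := fun h => hp ((lsym_eq_zero_iff (fine n M) hn _).mp h)
  rw [lsym_pOf] at hl
  rw [DeltaXi_shift_ofReal]
  exact hl

/-- **`Δ(p′+l)²·h′_l(p′) = ū(p′+l)·Δ′_j(p′)`** at every torus momentum and every alias (`h′_l = ūρ_l²/𝒩`, `ρ_l = Δ(p′)/Δ(p′+l)`,
`Δ′_j = Δ(p′)²/𝒩`; at `l = 0` `ρ_0 = 1`). [cite: Balaban1984PropagatorsII, (2.100)–(2.101) p.241, (2.107)–(2.108) p.242 (regrouping ours)] [folklore] -/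
theorem symbol_2100 (k : Fin d → Fin n) (q : Tor M) :
    DeltaXi n 0 (shift n k (ofRealVec (sOf M q))) ^ 2 * hP n k (ofRealVec (sOf M q))
      = uCbar n k (ofRealVec (sOf M q)) * dP n (ofRealVec (sOf M q)) := by
  unfold hP dP rho
  by_cases hk : k = fun _ => 0
  · subst hk
    rw [if_pos rfl, shift_zero]
    ring
  · rw [if_neg hk]
    have hkq : (k, q) ≠ ((fun _ => 0), 0) := fun h => hk (congrArg Prod.fst h)
    have hD := DeltaXi_shift_sOf_ne_zero n M hkq
    field_simp

end Symbol

/-! ## §3. `Δ²H′_j = Q′_j*Δ′_j` — (2.99)/(2.100)/(2.101) for the typed operators -/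

section EulerLagrange

variable (n : ℕ) [NeZero n] (M : Fin d → ℕ) [hM : ∀ μ, NeZero (M μ)]

/-- the normalisation constants: `c⁻¹ = n^d·c`, `c = cQ = (√(n^d))⁻¹`. [folklore] -/
private theorem cQ_inv_eq : ((cQ n M : ℂ))⁻¹ = (n : ℂ) ^ d * (cQ n M : ℂ) := by
  have hn0 : (0 : ℝ) ≤ (n : ℝ) ^ d := pow_nonneg (Nat.cast_nonneg n) d
  have hnpos : (0 : ℝ) < (n : ℝ) ^ d := pow_pos (Nat.cast_pos.mpr (Nat.pos_of_ne_zero (NeZero.ne n))) d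
  have hs : Real.sqrt ((n : ℝ) ^ d) ≠ 0 := (Real.sqrt_pos.mpr hnpos).ne'
  have hreal : (cQ n M)⁻¹ = (n : ℝ) ^ d * cQ n M := by
    rw [cQ_eq, inv_inv, eq_comm, mul_inv_eq_iff_eq_mul₀ hs, Real.mul_self_sqrt hn0]
  have h := congrArg (fun r : ℝ => (r : ℂ)) hreal
  push_cast at h
  exact h

/-- **`Δ²(H′_jμ) = n^d·(QsOp)ᴴ(Δ′_jμ) = Q′_j*(Δ′_jμ)` FOR EVERY `μ`** — the typed `λ = H′_jμ` satisfies `Δ²λ ∈ Range Q′_j*`,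
i.e. (2.99) *"(I − P_j)Δλ = 0"* / (2.100), with the Lagrange multiplier `Δ′_jμ`; in momentum space this is, alias by
alias, `Δ(p′+l)²·c⁻¹h′_l(p′)μ̂(p′) = n^d·c·ū(p′+l)·Δ′_j(p′)μ̂(p′)` (`symbol_2100`, `B5Adjoint130.dft_QsOp_adjoint`,
`B6Hprime2132Torus.dft_HpOp`). [cite: Balaban1984PropagatorsII, (2.99)–(2.101) p.241] [folklore] -/
theorem LapS_LapS_HpOp_mulVec (μf : Tor M → ℂ) :
    LapS (fine n M) (n : ℂ) *ᵥ (LapS (fine n M) (n : ℂ) *ᵥ (HpOp n M *ᵥ μf))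
      = ((n : ℂ) ^ d) • ((QsOp n M)ᴴ *ᵥ (dPOp n M *ᵥ μf)) := by
  apply dft_mulVec_injective (fine n M)
  funext p
  obtain ⟨⟨k, q⟩, rfl⟩ := (pOf_bijective n M).2 p
  show (dft (fine n M) *ᵥ (LapS (fine n M) (n : ℂ) *ᵥ (LapS (fine n M) (n : ℂ) *ᵥ (HpOp n M *ᵥ μf)))) (pOf n M (k, q))
    = (dft (fine n M) *ᵥ (((n : ℂ) ^ d) • ((QsOp n M)ᴴ *ᵥ (dPOp n M *ᵥ μf)))) (pOf n M (k, q))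
  rw [dft_LapS_apply, dft_LapS_apply, dft_HpOp, Matrix.mulVec_smul, Pi.smul_apply, smul_eq_mul, dft_QsOp_adjoint,
    dft_dPOp, lsym_pOf, ← DeltaXi_shift_ofReal, ← uCbar_ofReal, cQ_inv_eq]
  have h := symbol_2100 n M k q
  calc _ = (DeltaXi n 0 (shift n k (ofRealVec (sOf M q))) ^ 2 * hP n k (ofRealVec (sOf M q))) *
        ((n : ℂ) ^ d * (cQ n M : ℂ)) * (dft M *ᵥ μf) q := by ring
    _ = (uCbar n k (ofRealVec (sOf M q)) * dP n (ofRealVec (sOf M q))) * ((n : ℂ) ^ d * (cQ n M : ℂ)) *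
        (dft M *ᵥ μf) q := by rw [h]
    _ = _ := by ring

/-- the same as an identity of typed operators: `Δ²·H′_j = n^d·(QsOp)ᴴ·Δ′_j`. [cite: Balaban1984PropagatorsII, (2.100)–(2.101) p.241] [folklore] -/
theorem LapS_mul_LapS_mul_HpOp :
    LapS (fine n M) (n : ℂ) * LapS (fine n M) (n : ℂ) * HpOp n M = ((n : ℂ) ^ d) • ((QsOp n M)ᴴ * dPOp n M) :=
  Matrix.ext_of_mulVec_single fun y => by
    rw [← Matrix.mulVec_mulVec, ← Matrix.mulVec_mulVec, LapS_LapS_HpOp_mulVec, Matrix.smul_mulVec,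
      ← Matrix.mulVec_mulVec]

end EulerLagrange

/-! ## §4. (2.107): `H′_j*Δ²H′_j = Δ′_j` for the typed operators -/

section Eq2107

variable (n : ℕ) [NeZero n] (M : Fin d → ℕ) [hM : ∀ μ, NeZero (M μ)]

/-- **(2.107) `Δ′_j = H′_j*Δ²H′_j`** as an identity of typed torus operators: `(HpOp)ᴴ·Δ·Δ·HpOp = n^d·dPOp` (the factor `n^d`
is the weight dictionary `H′_j* = η^d(HpOp)ᴴ`, `Q′_j* = η^{−d}(QsOp)ᴴ`; proof: §3 and `Q′_jH′_j = 1`, `(QsOp·HpOp)ᴴ = 1`).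
[cite: Balaban1984PropagatorsII, (2.107) p.242 «Δ′_j = H′_j*Δ²H′_j»] [folklore] -/
theorem eq2107_typed :
    (HpOp n M)ᴴ * (LapS (fine n M) (n : ℂ) * LapS (fine n M) (n : ℂ) * HpOp n M) = ((n : ℂ) ^ d) • dPOp n M := by
  rw [LapS_mul_LapS_mul_HpOp, Matrix.mul_smul, ← Matrix.mul_assoc, ← Matrix.conjTranspose_mul, QsOp_mul_HpOp,
    Matrix.conjTranspose_one, Matrix.one_mul]

end Eq2107

/-! ## §5. (2.102): `λ = H′_jμ` minimises `½‖Δλ′‖²` on `{Q′_jλ′ = μ}`, uniquely -/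

section Variational

variable (n : ℕ) [NeZero n] (M : Fin d → ℕ) [hM : ∀ μ, NeZero (M μ)]

/-- the cross term vanishes: for `Q′_jξ = 0`, `⟨Δξ, Δ(H′_jμ)⟩ = ⟨ξ, Δ²H′_jμ⟩ = n^d⟨Q′_jξ, Δ′_jμ⟩ = 0`. [folklore] -/
private theorem cross_term_eq_zero (μf : Tor M → ℂ) (ξ : Tor (fine n M) → ℂ) (hξ : QsOp n M *ᵥ ξ = 0) :
    star (LapS (fine n M) (n : ℂ) *ᵥ ξ) ⬝ᵥ (LapS (fine n M) (n : ℂ) *ᵥ (HpOp n M *ᵥ μf)) = 0 := by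
  have hH : (LapS (fine n M) (n : ℂ))ᴴ = LapS (fine n M) (n : ℂ) := LapS_isHermitian (fine n M) (n : ℂ)
  rw [Matrix.star_mulVec, hH, ← Matrix.dotProduct_mulVec, LapS_LapS_HpOp_mulVec, dotProduct_smul,
    Matrix.dotProduct_mulVec, Matrix.vecMul_conjTranspose, star_star, hξ, star_zero, zero_dotProduct, smul_zero]

/-- **(2.102) FOR THE TYPED OPERATOR — `λ = H′_jμ` MINIMISES `‖Δλ′‖²` AMONG ALL `λ′` WITH `Q′_jλ′ = μ`**:
`‖Δ(H′_jμ)‖² ≤ ‖Δλ′‖²` (squared `ℓ²` norms on the fine torus written as `Re⟨v, v⟩`; the common weight `η^d` is irrelevant).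
[cite: Balaban1984PropagatorsII, (2.102) p.241 «It gives a solution of the variational problem inf_{λ′: Q′_jλ′=μ} ½‖Δλ′‖²»] [folklore] -/
theorem variational_2102 (μf : Tor M → ℂ) (lam' : Tor (fine n M) → ℂ) (hlam : QsOp n M *ᵥ lam' = μf) :
    (star (LapS (fine n M) (n : ℂ) *ᵥ (HpOp n M *ᵥ μf)) ⬝ᵥ (LapS (fine n M) (n : ℂ) *ᵥ (HpOp n M *ᵥ μf))).re
      ≤ (star (LapS (fine n M) (n : ℂ) *ᵥ lam') ⬝ᵥ (LapS (fine n M) (n : ℂ) *ᵥ lam')).re := by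
  set lam0 : Tor (fine n M) → ℂ := HpOp n M *ᵥ μf with hlam0
  set ξ : Tor (fine n M) → ℂ := lam' - lam0 with hξdef
  have hξ : QsOp n M *ᵥ ξ = 0 := by
    rw [hξdef, Matrix.mulVec_sub, hlam, hlam0, QsOp_HpOp_mulVec, sub_self]
  have hdecomp : lam' = lam0 + ξ := by rw [hξdef]; abel
  have hcross := cross_term_eq_zero n M μf ξ hξ
  have hcross' : star (LapS (fine n M) (n : ℂ) *ᵥ lam0) ⬝ᵥ (LapS (fine n M) (n : ℂ) *ᵥ ξ) = 0 := by
    rw [Matrix.star_dotProduct, hcross, star_zero]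
  rw [hdecomp, Matrix.mulVec_add, star_add, add_dotProduct, dotProduct_add, dotProduct_add, hcross, hcross',
    add_zero, zero_add, Complex.add_re]
  have hnn : 0 ≤ (star (LapS (fine n M) (n : ℂ) *ᵥ ξ) ⬝ᵥ (LapS (fine n M) (n : ℂ) *ᵥ ξ)).re := by
    rw [dotProduct, Complex.re_sum]
    exact Finset.sum_nonneg fun x _ => by
      rw [Pi.star_apply, Complex.star_def, Complex.mul_re, Complex.conj_re, Complex.conj_im]
      nlinarith [sq_nonneg ((LapS (fine n M) (n : ℂ) *ᵥ ξ) x).re, sq_nonneg ((LapS (fine n M) (n : ℂ) *ᵥ ξ) x).im]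
  linarith

/-- a fine-lattice function with `Δξ = 0` is constant: its DFT is supported at `p = 0`
(`B5Momentum130.lsym_eq_zero_iff`), and then it is annihilated by `Q′_j` only if it vanishes (`(Q′_jξ)^(0) = c·ξ̂(0)`).
[folklore] -/
private theorem eq_zero_of_LapS_eq_zero_of_QsOp_eq_zero (ξ : Tor (fine n M) → ℂ)
    (hΔ : LapS (fine n M) (n : ℂ) *ᵥ ξ = 0) (hQ : QsOp n M *ᵥ ξ = 0) : ξ = 0 := by
  have hn : (n : ℂ) ≠ 0 := by exact_mod_cast NeZero.ne n
  have hcQ := cQ_ne_zero n M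
  apply dft_mulVec_injective (fine n M)
  funext p
  show (dft (fine n M) *ᵥ ξ) p = (dft (fine n M) *ᵥ (0 : Tor (fine n M) → ℂ)) p
  rw [Matrix.mulVec_zero, Pi.zero_apply]
  by_cases hp : p = 0
  · -- the zero mode: read off `(Q′ξ)^(0) = c · Σ_l u_l(0) ξ̂(l) = c · ξ̂(0)`
    have h0 := congrFun (congrArg (fun f => dft M *ᵥ f) hQ) 0
    simp only [Matrix.mulVec_zero, Pi.zero_apply] at h0
    rw [dft_QsOp] at h0
    have hsum : ∑ k : Fin d → Fin n, uSym n k (sOf M 0) * (dft (fine n M) *ᵥ ξ) (pOf n M (k, 0))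
        = (dft (fine n M) *ᵥ ξ) (pOf n M ((fun _ => 0), 0)) := by
      rw [Finset.sum_eq_single (fun _ => (0 : Fin n))]
      · rw [B5Prop11Plancherel.sOf_zero, B5Hk163Torus.uSym_zero163, one_mul]
      · intro k _ hk
        have hk' : k ≠ 0 := fun h => hk (h.trans rfl)
        have hu := B5Block118.uSym_sOf_zero n M k
        rw [B5Prop11Plancherel.sOf_zero, if_neg hk'] at hu
        rw [B5Prop11Plancherel.sOf_zero, hu, zero_mul]
      · intro h; exact absurd (Finset.mem_univ _) h
    rw [hsum] at h0
    have hp0 : pOf n M ((fun _ => 0), 0) = 0 := by funext ν; simp [pOf]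
    rw [hp0] at h0
    rw [hp]
    rcases mul_eq_zero.mp h0 with h | h
    · exact absurd h hcQ
    · exact h
  · have h1 := congrFun (congrArg (fun f => dft (fine n M) *ᵥ f) hΔ) p
    simp only [Matrix.mulVec_zero, Pi.zero_apply] at h1
    rw [dft_LapS_apply] at h1
    rcases mul_eq_zero.mp h1 with h | h
    · exact absurd ((lsym_eq_zero_iff (fine n M) hn p).mp h) hp
    · exact h

/-- **UNIQUENESS OF THE MINIMISER — `HpOp` IS THE `H′_j` OF (2.101)**: if `Q′_jλ′ = μ` and `‖Δλ′‖² ≤ ‖Δ(H′_jμ)‖²` then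
`λ′ = H′_jμ` (`‖Δλ′‖² = ‖Δ(H′_jμ)‖² + ‖Δ(λ′ − H′_jμ)‖²`, so `Δ(λ′ − H′_jμ) = 0`, and a `Δ`-harmonic function annihilated
by `Q′_j` vanishes). [cite: Balaban1984PropagatorsII, (2.101)–(2.102) p.241 «Let us denote the operator in (2.101) by H′_j, so λ = H′_jμ»] [folklore] -/
theorem eq_HpOp_of_minimiser (μf : Tor M → ℂ) (lam' : Tor (fine n M) → ℂ) (hlam : QsOp n M *ᵥ lam' = μf)
    (hmin : (star (LapS (fine n M) (n : ℂ) *ᵥ lam') ⬝ᵥ (LapS (fine n M) (n : ℂ) *ᵥ lam')).re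
      ≤ (star (LapS (fine n M) (n : ℂ) *ᵥ (HpOp n M *ᵥ μf)) ⬝ᵥ (LapS (fine n M) (n : ℂ) *ᵥ (HpOp n M *ᵥ μf))).re) :
    lam' = HpOp n M *ᵥ μf := by
  set lam0 : Tor (fine n M) → ℂ := HpOp n M *ᵥ μf with hlam0
  set ξ : Tor (fine n M) → ℂ := lam' - lam0 with hξdef
  have hξ : QsOp n M *ᵥ ξ = 0 := by
    rw [hξdef, Matrix.mulVec_sub, hlam, hlam0, QsOp_HpOp_mulVec, sub_self]
  have hdecomp : lam' = lam0 + ξ := by rw [hξdef]; abel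
  have hcross := cross_term_eq_zero n M μf ξ hξ
  have hcross' : star (LapS (fine n M) (n : ℂ) *ᵥ lam0) ⬝ᵥ (LapS (fine n M) (n : ℂ) *ᵥ ξ) = 0 := by
    rw [Matrix.star_dotProduct, hcross, star_zero]
  have hexp : (star (LapS (fine n M) (n : ℂ) *ᵥ lam') ⬝ᵥ (LapS (fine n M) (n : ℂ) *ᵥ lam')).re
      = (star (LapS (fine n M) (n : ℂ) *ᵥ lam0) ⬝ᵥ (LapS (fine n M) (n : ℂ) *ᵥ lam0)).re
        + (star (LapS (fine n M) (n : ℂ) *ᵥ ξ) ⬝ᵥ (LapS (fine n M) (n : ℂ) *ᵥ ξ)).re := by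
    rw [hdecomp, Matrix.mulVec_add, star_add, add_dotProduct, dotProduct_add, dotProduct_add, hcross, hcross',
      add_zero, zero_add, Complex.add_re]
  -- each term of `Re⟨Δξ, Δξ⟩ = Σ|Δξ(x)|²` is non-negative and the sum is ≤ 0, hence every `Δξ(x) = 0`
  set v : Tor (fine n M) → ℂ := LapS (fine n M) (n : ℂ) *ᵥ ξ with hv
  have hterm : (star v ⬝ᵥ v).re = ∑ x, (((v x).re) ^ 2 + ((v x).im) ^ 2) := by
    rw [dotProduct, Complex.re_sum]
    refine Finset.sum_congr rfl fun x _ => ?_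
    rw [Pi.star_apply, Complex.star_def, Complex.mul_re, Complex.conj_re, Complex.conj_im]
    ring
  have hle : (star v ⬝ᵥ v).re ≤ 0 := by linarith
  have hsum0 : ∑ x, (((v x).re) ^ 2 + ((v x).im) ^ 2) = 0 := by
    have hge : 0 ≤ ∑ x, (((v x).re) ^ 2 + ((v x).im) ^ 2) := Finset.sum_nonneg fun x _ => by positivity
    linarith
  have hvx : ∀ x, v x = 0 := by
    intro x
    have hx := (Finset.sum_eq_zero_iff_of_nonneg (fun x _ => by positivity)).mp hsum0 x (Finset.mem_univ x)
    have hre : (v x).re = 0 := by nlinarith [sq_nonneg (v x).re, sq_nonneg (v x).im]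
    have him : (v x).im = 0 := by nlinarith [sq_nonneg (v x).re, sq_nonneg (v x).im]
    exact Complex.ext hre him
  have hΔ : LapS (fine n M) (n : ℂ) *ᵥ ξ = 0 := funext hvx
  have hξ0 := eq_zero_of_LapS_eq_zero_of_QsOp_eq_zero n M ξ hΔ hξ
  rw [hdecomp, hξ0, add_zero]

end Variational

end

end Literature.MathematicalPhysics.QuantumFieldTheory.Balaban1983to89.B6Hprime2101TorusAlgebra
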